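import Literature.NumberTheory.Automorphic.CompletedCohomology
import HarnessLib

/-!
# Compatibility of Hecke operators with change of level

Topic `NumberTheory/Automorphic`, namespace `Literature.NumberTheory.Automorphic.ArithmeticQuotient`.

The Hecke operator `[L g L]` on `H^i(X_L, M)` and `[L' g L']` on `H^i(X_{L'}, M)` (`L' ≤ L`) commute
with the pull-back `H^i(X_L, M) → H^i(X_{L'}, M)` as soon as the projection `𝒢 ⧸ L' → 𝒢 ⧸ L`
maps `L' g L' / L'` bijectively onto `L g L / L` (`heckeFun_comp_quotientMapOfLE`,
`heckeOperator_comp_cohomologyPullback`).  Group-theoretically this holds iff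
`L = L' · (L ∩ g L g⁻¹)` and `L' ∩ g L g⁻¹ = L' ∩ g L' g⁻¹`; the standard instance is a tower
`K(s) = Kᵖ K_p(p^s)` whose levels differ only at `p` and a Hecke element `g` trivial at `p`
(e.g. `t_{v,j}`, `v ∤ p`), where both sides are `Kᵖ gᵖ Kᵖ / Kᵖ`.  Consequently such `g` are
`IsTowerCompatible` (`isTowerCompatible_of_bijOn`) and act on completed cohomology through
`completedHeckeMod` / `completedHecke` of `CompletedCohomology`.  This is the level-compatibility
underlying the action of the prime-to-`p` Hecke algebra on `H̃^•` [Emerton2006, §2.2],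
[CalegariEmerton2011, §5]; the verification of the bijectivity hypothesis for concrete adelic
levels of `GL_n` is not done here.

## References

* M. Emerton, Invent. Math. 164 (2006), §2.2 [Emerton2006].
* G. Shimura, *Introduction to the arithmetic theory of automorphic functions* (1971), Ch. 3
  (Prop. 3.1: commensurability and double cosets) [ShimuraIATAF1971].
-/

noncomputable section

open CategoryTheory

universe u

namespace Literature.NumberTheory.Automorphic

namespace ArithmeticQuotient

variable (k : Type u) [CommRing k] {Γ 𝒢 : Type u} [Group Γ] [Group 𝒢]
variable (ι : Γ →* 𝒢) {L L' : Subgroup 𝒢} (M : Type u) [AddCommGroup M] [Module k M]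

omit [Group Γ] in
variable {k M} in
/-- If `𝒢 ⧸ L' → 𝒢 ⧸ L` maps `L' g L' / L'` bijectively onto `L g L / L` and the latter is finite,
the Hecke operators `[L' g L']` and `[L g L]` on functions commute with pull-back:
`T^{L'}_g (f ∘ q) = (T^L_g f) ∘ q`. [cite: ShimuraIATAF1971, Ch. 3, Prop. 3.1] -/
theorem heckeFun_comp_quotientMapOfLE (h : L' ≤ L) (g : 𝒢)
    (hbij : Set.BijOn (Subgroup.quotientMapOfLE h) (doubleCosetQuot L' g) (doubleCosetQuot L g))
    (hfin : (doubleCosetQuot L g).Finite) (f : (𝒢 ⧸ L) → M) :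
    heckeFun k L' g M (f ∘ Subgroup.quotientMapOfLE h) =
      heckeFun k L g M f ∘ Subgroup.quotientMapOfLE h := by
  have hfin' : (doubleCosetQuot L' g).Finite :=
    Set.Finite.of_finite_image (hbij.image_eq.symm ▸ hfin) hbij.injOn
  funext c
  induction c using QuotientGroup.induction_on with
  | H x =>
    rw [Function.comp_apply, heckeFun_apply_coe k L' M g _ x hfin',
      show Subgroup.quotientMapOfLE h (x : 𝒢 ⧸ L') = (x : 𝒢 ⧸ L) from rfl,
      heckeFun_apply_coe k L M g f x hfin]
    simp only [Function.comp_apply, quotientMapOfLE_smul]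
    refine Finset.sum_nbij (Subgroup.quotientMapOfLE h) (fun d hd => ?_) ?_ ?_ fun _ _ => rfl
    · rw [Set.Finite.mem_toFinset] at hd ⊢
      exact hbij.mapsTo hd
    · rw [Set.Finite.coe_toFinset]
      exact hbij.injOn
    · rw [Set.Finite.coe_toFinset, Set.Finite.coe_toFinset]
      exact hbij.surjOn

omit [Group Γ] in
/-- **Group-theoretic criterion** for the bijection `L' g L' / L' → L g L / L`: it suffices that
(a) every `l ∈ L` factors as `l = l' · g m g⁻¹` with `l' ∈ L'`, `m ∈ L` (i.e. `L = L' (L ∩ gLg⁻¹)`),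
and (b) `l' ∈ L'`, `g⁻¹ l' g ∈ L` imply `g⁻¹ l' g ∈ L'` (i.e. `L' ∩ gLg⁻¹ ⊆ gL'g⁻¹`).  For a tower
`Kᵖ K_p(p^s)` and `g` trivial at `p` both hold with `l' =` the `p`-component of `l`.
[cite: ShimuraIATAF1971, Ch. 3, Prop. 3.1] -/
theorem bijOn_doubleCosetQuot (h : L' ≤ L) (g : 𝒢)
    (ha : ∀ l ∈ L, ∃ l' ∈ L', ∃ m ∈ L, l = l' * (g * m * g⁻¹))
    (hb : ∀ l' ∈ L', g⁻¹ * l' * g ∈ L → g⁻¹ * l' * g ∈ L') :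
    Set.BijOn (Subgroup.quotientMapOfLE h) (doubleCosetQuot L' g) (doubleCosetQuot L g) := by
  refine ⟨?_, ?_, ?_⟩
  · rintro _ ⟨l', rfl⟩
    exact ⟨⟨l', h l'.2⟩, rfl⟩
  · rintro _ ⟨l₁, rfl⟩ _ ⟨l₂, rfl⟩ he
    change ((l₁ : 𝒢) * g : 𝒢 ⧸ L) = ((l₂ : 𝒢) * g : 𝒢 ⧸ L) at he
    change (((l₁ : 𝒢) * g : 𝒢) : 𝒢 ⧸ L') = (((l₂ : 𝒢) * g : 𝒢) : 𝒢 ⧸ L')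
    rw [QuotientGroup.eq] at he ⊢
    have he' : g⁻¹ * ((l₁ : 𝒢)⁻¹ * l₂) * g ∈ L := by
      simpa only [mul_inv_rev, mul_assoc] using he
    have := hb _ (L'.mul_mem (L'.inv_mem l₁.2) l₂.2) he'
    simpa only [mul_inv_rev, mul_assoc] using this
  · rintro _ ⟨l, rfl⟩
    obtain ⟨l', hl', m, hm, hl⟩ := ha l l.2
    refine ⟨(⟨l', hl'⟩ : L') • (g : 𝒢 ⧸ L'), ⟨⟨l', hl'⟩, rfl⟩, ?_⟩
    change (((l' * g : 𝒢)) : 𝒢 ⧸ L) = ((l : 𝒢) * g : 𝒢 ⧸ L)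
    rw [QuotientGroup.eq, hl]
    simpa [mul_assoc] using hm

/-- Under the bijectivity hypothesis of `heckeFun_comp_quotientMapOfLE`, the Hecke operators on the
coefficient representations commute with the pull-back morphism. [folklore] -/
theorem heckeRepHom_comp_pullbackHom (h : L' ≤ L) (g : 𝒢)
    (hbij : Set.BijOn (Subgroup.quotientMapOfLE h) (doubleCosetQuot L' g) (doubleCosetQuot L g))
    (hfin : (doubleCosetQuot L g).Finite) :
    heckeRepHom k L g M ι ≫ pullbackHom k ι M h = pullbackHom k ι M h ≫ heckeRepHom k L' g M ι :=
  Rep.hom_ext (Representation.IntertwiningMap.ext (LinearMap.ext fun f =>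
    (heckeFun_comp_quotientMapOfLE (k := k) h g hbij hfin f).symm))

/-- **Hecke operators commute with pull-back in cohomology** when `L' g L' / L' → L g L / L` is a
bijection (e.g. levels differing only at `p` and `g` trivial at `p`):
`T^{L}_g` then `H^i(X_L) → H^i(X_{L'})` equals the pull-back followed by `T^{L'}_g`.
[cite: Emerton2006, §2.2] -/
theorem heckeOperator_comp_cohomologyPullback (h : L' ≤ L) (g : 𝒢)
    (hbij : Set.BijOn (Subgroup.quotientMapOfLE h) (doubleCosetQuot L' g) (doubleCosetQuot L g))
    (hfin : (doubleCosetQuot L g).Finite) (i : ℕ) :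
    heckeOperator k L g M ι i ≫ cohomologyPullback k ι M h i =
      cohomologyPullback k ι M h i ≫ heckeOperator k L' g M ι i := by
  rw [heckeOperator, cohomologyPullback, ← groupCohomology.map_id_comp,
    heckeRepHom_comp_pullbackHom k ι M h g hbij hfin, groupCohomology.map_id_comp]

end ArithmeticQuotient

/-! ### Consequence for towers -/

section Tower

variable (k : Type u) [CommRing k] {Γ 𝒢 : Type u} [Group Γ] [Group 𝒢]
variable (ι : Γ →* 𝒢) (T : LevelTower 𝒢) (ϖ : k)

/-- A Hecke element `g` whose double cosets `K(s') g K(s') / K(s') → K(s) g K(s) / K(s)` are finite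
and correspond bijectively along the tower is tower-compatible, hence acts on completed
cohomology (`completedHeckeMod`, `completedHecke`). [cite: Emerton2006, §2.2] -/
theorem isTowerCompatible_of_bijOn (g : 𝒢)
    (hbij : ∀ {s s' : ℕ} (h : s ≤ s'), Set.BijOn (Subgroup.quotientMapOfLE (T.level_le h))
      (ArithmeticQuotient.doubleCosetQuot (T.level s') g) (ArithmeticQuotient.doubleCosetQuot (T.level s) g))
    (hfin : ∀ s : ℕ, (ArithmeticQuotient.doubleCosetQuot (T.level s) g).Finite) :
    IsTowerCompatible k ι T ϖ g := by
  intro i t s s' h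
  rw [towerTransition, ← ModuleCat.hom_comp, ← ModuleCat.hom_comp, towerPullback,
    ArithmeticQuotient.heckeOperator_comp_cohomologyPullback k ι (modPow k ϖ t) (T.level_le h) g
      (hbij h) (hfin s) i]

end Tower

end Literature.NumberTheory.Automorphic
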